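import Mathlib.AlgebraicGeometry.Modules.Sheaf
import Mathlib.AlgebraicGeometry.IdealSheaf.Basic
import Mathlib.Algebra.Category.ModuleCat.Presheaf.Submodule
import Mathlib.Algebra.Module.Torsion.Basic
import Mathlib.Topology.Sheaves.SheafCondition.UniqueGluing
import HarnessLib

/-!
# The `𝒥`-torsion subsheaf `M[𝒥]` of a sheaf of `𝒪_X`-modules for an ideal sheaf `𝒥`

For a scheme `X`, a sheaf of `𝒪_X`-modules `M : X.Modules` and an ideal sheaf `𝒥` given by its
affine-local data `J : X.IdealSheafData` (Mathlib), the sections of `M` ANNIHILATED BY `𝒥` form a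
subsheaf of modules `M[𝒥] ⊆ M` (`torsion M J`): a section `m ∈ Γ(U, M)` belongs to it iff
`r • m|_V = 0` for every affine open `V ⊆ U` and every `r ∈ 𝒥(V)` (`IsTorsionSection`); over an AFFINE
`U` this just says `𝒥(U) • m = 0` (`isTorsionSection_iff_of_isAffineOpen`, since `𝒥(V)` is generated
by `𝒥(U)|_V`, Mathlib `IdealSheafData.map_ideal`). This is the subsheaf `𝓗om_{𝒪_X}(𝒪_X/𝒥, M) ⊆ M`
(cf. Hartshorne II Ex. 5.6 (d): `Γ_𝔞(M) = {m ∈ M | 𝔞ⁿ m = 0 for some n}`, of which it is the part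
`n = 1`, and Ex. 1.20, the subsheaf with supports); it is the device by which the dévissage of coherent
modules (Görtz–Wedhorn I, Lemma 12.63 (ii)) splits a module along a nilpotent ideal or along the
components of its support.

* `torsionSubmodule M J` — the family of submodules, stable under restriction (Mathlib
  `PresheafOfModules.Submodule`), and `torsion M J : X.Modules` — it IS a sheaf (the condition is
  local: `isSheaf_torsion`), with the monomorphism `torsionι M J : torsion M J ⟶ M` whose sections are
  the inclusions of the submodules (definitionally);
* `isTorsionSection_iff_of_isAffineOpen` — the affine description;
* `IsKilledBy J N` — "`𝒥 N = 0`" (on affine opens), with `isKilledBy_torsion : IsKilledBy J (torsion M J)`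
  and `isTorsionSection_of_isKilledBy`.

Everything is proved; no named facts. Mathlib searched (pin v4.32): `PresheafOfModules.Submodule`
(`toPresheafOfModules`, `ι`, mono), `Scheme.IdealSheafData` (`map_ideal`, `ideal_le_comap_ideal`),
`Ideal.torsionOf`, `TopCat.Presheaf.isSheaf_iff_isSheafUniqueGluing` (used); Mathlib has no torsion /
annihilator subsheaves of modules.

## References

* R. Hartshorne, *Algebraic Geometry*, GTM 52 (1977): II Ex. 1.20 (p. 68, PDF p. 91) and II Ex. 5.6
  (Support; (d) `Γ_𝔞(M)`), p. 124 (PDF p. 157) (read via the held copy). [Hartshorne1977]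
* U. Görtz, T. Wedhorn, *Algebraic Geometry I: Schemes*, 2nd ed. (2020): Lemma 12.63 (ii), p. 436.
  [GortzWedhorn2020]
-/

noncomputable section

open CategoryTheory AlgebraicGeometry TopologicalSpace Opposite

universe u

namespace Literature.AlgebraicGeometry.Modules

variable {X : Scheme.{u}} (M : X.Modules) (J : X.IdealSheafData)

/-! ## Torsion sections -/

/-- A section `m ∈ Γ(U, M)` is a **`𝒥`-torsion section** if `r • m|_V = 0` for every affine open
`V ⊆ U` and every `r ∈ 𝒥(V)`. [folklore] -/
def IsTorsionSection (U : X.Opens) (m : Γ(M, U)) : Prop :=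
  ∀ (V : X.affineOpens) (hV : (V : X.Opens) ≤ U) (r : Γ(X, V)), r ∈ J.ideal V →
    r • M.presheaf.map (homOfLE hV).op m = 0

variable {M J} in
/-- Torsion sections restrict to torsion sections. [folklore] -/
theorem IsTorsionSection.map {U W : X.Opens} {m : Γ(M, U)} (hm : IsTorsionSection M J U m) (h : W ≤ U) :
    IsTorsionSection M J W (M.presheaf.map (homOfLE h).op m) := by
  intro V hV r hr
  rw [← CategoryTheory.comp_apply, ← Functor.map_comp]
  exact (congrArg (fun φ => r • M.presheaf.map φ m) (Subsingleton.elim _ _)).trans (hm V (hV.trans h) r hr)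

/-- The `𝒥`-torsion sections over `U` form a `Γ(U, 𝒪_X)`-submodule of `Γ(U, M)`. [folklore] -/
def torsionSubmoduleObj (U : X.Opens) : Submodule Γ(X, U) Γ(M, U) where
  carrier := {m | IsTorsionSection M J U m}
  zero_mem' := fun V hV r _ => by rw [map_zero, smul_zero]
  add_mem' := fun {a b} ha hb V hV r hr => by rw [map_add, smul_add, ha V hV r hr, hb V hV r hr, add_zero]
  smul_mem' := fun t m hm V hV r hr => by
    rw [Scheme.Modules.map_smul, smul_smul, mul_comm, mul_smul, hm V hV r hr, smul_zero]

/-- Membership in `torsionSubmoduleObj`. [folklore] -/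
theorem mem_torsionSubmoduleObj_iff {U : X.Opens} (m : Γ(M, U)) :
    m ∈ torsionSubmoduleObj M J U ↔ IsTorsionSection M J U m := Iff.rfl

/-- **The family `U ↦ M[𝒥](U)` is stable under restriction**: a subobject of `M` in presheaves of
modules (Mathlib `PresheafOfModules.Submodule`). [folklore] -/
def torsionSubmodule : PresheafOfModules.Submodule M.val where
  obj U := torsionSubmoduleObj M J U.unop
  map {U W} f := fun m hm => by
    change IsTorsionSection M J W.unop (M.presheaf.map f m)
    have e : f = (homOfLE f.unop.le).op := Subsingleton.elim _ _
    rw [e]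
    exact IsTorsionSection.map hm f.unop.le

/-! ## The sheaf condition -/

/-- The sheaf of abelian groups underlying `M`. [folklore] -/
abbrev abSheafOf (M : X.Modules) : TopCat.Sheaf Ab X := ⟨M.presheaf, M.isSheaf⟩

/-- A section of `M` over `U` which is a torsion section on each member of a covering of `U` is a
torsion section (the condition is local; checked on affine opens inside each `U ∩ U_i` by the
locality of `M`). [folklore] -/
theorem isTorsionSection_of_locally {ι : Type u} (U : ι → X.Opens) (m : Γ(M, iSup U))
    (hm : ∀ i, IsTorsionSection M J (U i) (M.presheaf.map (homOfLE (le_iSup U i)).op m)) :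
    IsTorsionSection M J (iSup U) m := by
  intro V hV r hr
  -- check `r • m|_V = 0` locally on the affine opens `W ⊆ V ∩ U_i`
  let K : Type u := {W : X.affineOpens // ∃ i, (W : X.Opens) ≤ (V : X.Opens) ⊓ U i}
  have hcov : (V : X.Opens) ≤ ⨆ k : K, (k.1 : X.Opens) := by
    intro x hx
    have hx' : x ∈ iSup U := hV hx
    obtain ⟨i, hi⟩ := Opens.mem_iSup.mp hx'
    obtain ⟨W, hW, hxW, hWle⟩ :=
      Opens.isBasis_iff_nbhd.mp X.isBasis_affineOpens (show x ∈ (V : X.Opens) ⊓ U i from ⟨hx, hi⟩)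
    exact Opens.mem_iSup.mpr ⟨⟨⟨W, hW⟩, i, hWle⟩, hxW⟩
  apply (abSheafOf M).eq_of_locally_eq' (fun k : K => (k.1 : X.Opens)) V
    (fun k => homOfLE (k.2.choose_spec.trans inf_le_left)) hcov
  intro k
  obtain ⟨i, hi⟩ := k.2
  have hkV : (k.1 : X.Opens) ≤ V := hi.trans inf_le_left
  have hkU : (k.1 : X.Opens) ≤ U i := hi.trans inf_le_right
  rw [map_zero]
  change M.presheaf.map (homOfLE _).op (r • M.presheaf.map (homOfLE hV).op m) = 0
  rw [Scheme.Modules.map_smul, ← CategoryTheory.comp_apply, ← Functor.map_comp]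
  have key := hm i k.1 hkU (X.presheaf.map (homOfLE hkV).op r) (J.ideal_le_comap_ideal hkV hr)
  rw [← CategoryTheory.comp_apply, ← Functor.map_comp] at key
  exact (congrArg (fun φ => X.presheaf.map (homOfLE hkV).op r • M.presheaf.map φ m)
    (Subsingleton.elim _ _)).trans key

/-- **`M[𝒥]` is a sheaf.** [folklore] -/
theorem isSheaf_torsion :
    TopCat.Presheaf.IsSheaf (torsionSubmodule M J).toPresheafOfModules.presheaf := by
  rw [TopCat.Presheaf.isSheaf_iff_isSheafUniqueGluing]
  intro ι U sf hsf
  -- glue the underlying sections in `M`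
  have hsf' : TopCat.Presheaf.IsCompatible M.presheaf U fun i => (sf i).val := fun i j =>
    congrArg Subtype.val (hsf i j)
  obtain ⟨s, hs, huniq⟩ := M.isSheaf.isSheafUniqueGluing U (fun i => (sf i).val) hsf'
  have hstor : IsTorsionSection M J (iSup U) s :=
    isTorsionSection_of_locally M J U s fun i => by
      have e : (homOfLE (le_iSup U i)).op = (Opens.leSupr U i).op := Subsingleton.elim _ _
      rw [e, hs i]; exact (sf i).2
  refine ⟨⟨s, hstor⟩, fun i => Subtype.ext (hs i), fun t ht => Subtype.ext (huniq t.val fun i => ?_)⟩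
  exact congrArg Subtype.val (ht i)

/-- **The `𝒥`-torsion subsheaf `M[𝒥]`** of `M` (sections annihilated by `𝒥`), as a sheaf of
`𝒪_X`-modules (cf. Hartshorne II Ex. 5.6 (d), the case `n = 1`). [folklore] -/
def torsion : X.Modules := ⟨(torsionSubmodule M J).toPresheafOfModules, isSheaf_torsion M J⟩

/-- The inclusion `M[𝒥] ⟶ M`. [folklore] -/
def torsionι : torsion M J ⟶ M := ⟨(torsionSubmodule M J).ι⟩

/-- The sections of `M[𝒥]` over `U` are the torsion sections, the inclusion being the subtype
inclusion: definitionally. [folklore] -/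
theorem torsionι_app_apply (U : X.Opens) (m : Γ(torsion M J, U)) :
    (torsionι M J).app U m = (m : torsionSubmoduleObj M J U).val := rfl

/-- A section of `M[𝒥]` is a torsion section of `M`. [folklore] -/
theorem isTorsionSection_torsionι_app (U : X.Opens) (m : Γ(torsion M J, U)) :
    IsTorsionSection M J U ((torsionι M J).app U m) := (m : torsionSubmoduleObj M J U).2

/-- `torsionι` is injective on sections. [folklore] -/
theorem torsionι_app_injective (U : X.Opens) : Function.Injective ((torsionι M J).app U) :=
  fun _ _ h => Subtype.ext h

/-- A torsion section of `M` over `U` is a section of `M[𝒥]`. [folklore] -/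
theorem exists_torsionι_app_eq {U : X.Opens} (m : Γ(M, U)) (hm : IsTorsionSection M J U m) :
    ∃ m' : Γ(torsion M J, U), (torsionι M J).app U m' = m := ⟨⟨m, hm⟩, rfl⟩

/-- `M[𝒥] ⟶ M` is a monomorphism. [folklore] -/
instance mono_torsionι : Mono (torsionι M J) :=
  (Scheme.Modules.toPresheafOfModules X).mono_of_mono_map
    (inferInstanceAs (Mono (torsionSubmodule M J).ι))

/-! ## The affine description -/

/-- **Over an affine open `U`, `m` is a torsion section iff `𝒥(U) • m = 0`** (the ideals `𝒥(V)`,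
`V ⊆ U` affine, are generated by `𝒥(U)|_V`, Mathlib `IdealSheafData.map_ideal`). [folklore] -/
theorem isTorsionSection_iff_of_isAffineOpen {U : X.Opens} (hU : IsAffineOpen U) (m : Γ(M, U)) :
    IsTorsionSection M J U m ↔ ∀ r ∈ J.ideal ⟨U, hU⟩, r • m = 0 := by
  constructor
  · intro hm r hr
    have := hm ⟨U, hU⟩ le_rfl r hr
    have e : (homOfLE (le_refl U)).op = 𝟙 (op U) := Subsingleton.elim _ _
    rwa [e, M.presheaf.map_id] at this
  · intro hm V hV r hr
    -- `r ∈ 𝒥(V) = 𝒥(U)|_V · Γ(V)` annihilates `m|_V`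
    have hle : J.ideal V ≤ Ideal.torsionOf Γ(X, V) Γ(M, V) (M.presheaf.map (homOfLE hV).op m) := by
      rw [← J.map_ideal (U := V) (V := ⟨U, hU⟩) hV, Ideal.map_le_iff_le_comap]
      intro j hj
      rw [Ideal.mem_comap, Ideal.mem_torsionOf_iff]
      change X.presheaf.map (homOfLE hV).op j • M.presheaf.map (homOfLE hV).op m = 0
      rw [← Scheme.Modules.map_smul, hm j hj, map_zero]
    exact (Ideal.mem_torsionOf_iff _ _).mp (hle hr)

/-! ## Modules killed by `𝒥` -/

/-- **`𝒥 N = 0`**: on every affine open `V`, `𝒥(V)` annihilates `Γ(V, N)`. [folklore] -/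
def IsKilledBy (N : X.Modules) : Prop :=
  ∀ (V : X.affineOpens) (r : Γ(X, V)), r ∈ J.ideal V → ∀ n : Γ(N, V), r • n = 0

/-- If `𝒥 N = 0` then every section of `N` is a torsion section. [folklore] -/
theorem isTorsionSection_of_isKilledBy {N : X.Modules} (hN : IsKilledBy J N) (U : X.Opens)
    (n : Γ(N, U)) : IsTorsionSection N J U n :=
  fun V _ r hr => hN V r hr _

/-- **`𝒥 · M[𝒥] = 0`.** [folklore] -/
theorem isKilledBy_torsion : IsKilledBy J (torsion M J) := by
  intro V r hr n
  apply torsionι_app_injective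
  rw [Scheme.Modules.Hom.app_smul, map_zero]
  exact ((isTorsionSection_iff_of_isAffineOpen M J V.2 _).mp (isTorsionSection_torsionι_app M J V n)) r hr

/-- `IsKilledBy` is antitone in the ideal. [folklore] -/
theorem IsKilledBy.anti {N : X.Modules} {J J' : X.IdealSheafData} (h : J ≤ J') (hN : IsKilledBy J' N) :
    IsKilledBy J N :=
  fun V r hr n => hN V r (h V hr) n

end Literature.AlgebraicGeometry.Modules

end
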